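import Summits.AtomisticToContinuum.HydrodynamicLimit.Theorems.OneFlightGossipEngineEquilibriumClampedCollisionalWindowLDDefs
import Literature.Analysis.FluidPDE.CollisionalTransfer
import HarnessLib

/-!
# Sketch — crux idea `clausius-coboundary-split` for `ClampedTransferDock` (stmt-AtomisticToContinuum-17615)

Crux-ideate round 1, ideator 2 (planner-cruxidea-stmt-AtomisticToContinuum-17615-2-0, 2026-08-17).
Nothing here asserts a route decl; every `def … : Prop` is a STATEMENT of the idea card, typed over existing
declarations so that the triage panel can read exact quantifiers:

* `corrector`        — the CLAUSIUS CORRECTOR of the momentum row `k`: the isolation-weighted, shell-localised pair virial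
                        `C_k(z) = Σ_{i ≠ j} χ(r_ij/ε) I_ij(z) (φ(x_i) − φ(x_j)) ⟪v_i − v_j, s_ij⟫ s_ij,k / ‖s_ij‖²`
                        (`s_ij` the minimal-image separation, `χ` a `C¹` shell cut-off equal to `1` at contact, `I_ij` the smooth
                        ISOLATION weight = product over third spheres `l` of `(1 − χI(r_il/ε))(1 − χI(r_jl/ε))`, `χI(1) = 1`);
* `IsolatedJumpIdentity` (FIRST LEMMA) — along every hard-sphere orbit the collisional transfer (= sum of jumps) of `C_k` on
                        `(0, h]` is EXACTLY `4 ×` the isolation-weighted tested momentum transfer `Σ_records I_c payload_k / 2`: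
                        the colliding pair's own two ordered terms jump by `2 I (φ_i − φ_j) Δv_i` each, and NO OTHER TERM JUMPS
                        (a third-party term `(i,l)` carries the factor `1 − χI(r_ij/ε) = 0` while `i` touches `j`);
* `IsolatedTransferCoboundary` — with the landed weak balance law `HardSphereFlow.sub_eq_integral_add_collisionalTransfer`:
                        isolated tested transfer `= ¼ (C_k(Φ_h z) − C_k(z)) − ¼ ∫₀ʰ (L₀ C_k)(Φ_s z) ds`, `L₀` = free streaming;
* `CorrectorKineticBound` — `|C_k(z)| ≤ 248 L (1+δ) ε Σ_i ‖v_i‖` on the hard-sphere domain (kissing-type count `≤ 124`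
                        neighbours in the shell, `|φ(x_i) − φ(x_j)| ≤ L (1+δ) ε`): the boundary term is `O(σ/τ)` per particle;
* `ShellStressWindowLD` (the transferred statement C⁺ for the momentum rows, constant profiles = the rung of TwoClocks' C′) —
                        scale-`N` window LD at fixed small tilt for the ADDITIVE phase functional `−¼ w⁻¹ ∫₀ʷ L₀C_k` centred by an
                        EOS projection with isolated-pair coefficients; no clamp, no collision records;
* `ShadowedClampedTransferWindowLD` — the typed C′ momentum rows restricted to SHADOWED collisions (weight `1 − I_c`), clamp kept;
* `RecutMomentumRowsWindowLD`, `RecutReduction` — the re-cut momentum rows (isolated part unclamped + shadowed part clamped)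
                        and the Hölder/coboundary reduction to be proved at crux-plan.
-/

noncomputable section

open MeasureTheory Set Filter
open scoped ENNReal BigOperators
open Literature.Analysis.FluidPDE Literature.MathematicalPhysics.KineticTheory
open Literature.Analysis.FunctionSpaces (Torus.partialDeriv Torus.IsSmooth)
open Summit.AtomisticToContinuum.HydrodynamicLimit.Theorems.ClampedTransferCoin

namespace Summit.AtomisticToContinuum.HydrodynamicLimit.Cruxes.ClampedTransferDock.ClausiusCoboundary

/-! ## §0 Cut-offs and the corrector -/

/-- Minimal-image separation vector on `𝕋³`. -/
def sepT (x y : T3) : V3 := (Torus.geometry (Fin 3)).sepVec x y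

/-- Admissible shell / isolation cut-offs (arguments are `r/ε`): `C¹`, values in `[0,1]`, equal to `1` up to contact
`r = ε` (so that every term involving a touching third sphere vanishes identically) and to `0` beyond `(1+δ)ε`, `0 < δ ≤ 1`. -/
structure ShellCutoffs (δ : ℝ) (χ χI : ℝ → ℝ) : Prop where
  pos : 0 < δ
  le_one : δ ≤ 1
  smooth : ContDiff ℝ 1 χ
  smoothI : ContDiff ℝ 1 χI
  chi_one : ∀ r, r ≤ 1 → χ r = 1
  chi_zero : ∀ r, 1 + δ ≤ r → χ r = 0
  chi_mem : ∀ r, χ r ∈ Set.Icc (0 : ℝ) 1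
  chiI_one : ∀ r, r ≤ 1 → χI r = 1
  chiI_zero : ∀ r, 1 + δ ≤ r → χI r = 0
  chiI_mem : ∀ r, χI r ∈ Set.Icc (0 : ℝ) 1

/-- The smooth ISOLATION WEIGHT of the ordered pair `(i, j)`: `Π_{l ≠ i, j} (1 − χI(r_il/ε)) (1 − χI(r_jl/ε))` —
`1` iff no third sphere is within `(1+δ)ε` of either partner, `0` as soon as a third sphere TOUCHES either partner. -/
def isoWeight (χI : ℝ → ℝ) (ε : ℝ) {N : ℕ} (z : Phase N) (i j : Fin (N + 1)) : ℝ :=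
  ∏ l : Fin (N + 1), if l = i ∨ l = j then (1 : ℝ) else
    (1 - χI (‖sepT (z i).1 (z l).1‖ / ε)) * (1 - χI (‖sepT (z j).1 (z l).1‖ / ε))

/-- The radial form `⟪v_i − v_j, s_ij⟫ s_ij,k / ‖s_ij‖²` (jumps by `2 (Δv_i)_k` at a collision of `(i, j)`). -/
def radialForm {N : ℕ} (z : Phase N) (i j : Fin (N + 1)) (k : Fin 3) : ℝ :=
  (inner ℝ ((z i).2 - (z j).2) (sepT (z i).1 (z j).1) / ‖sepT (z i).1 (z j).1‖ ^ 2) * sepT (z i).1 (z j).1 k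

/-- **THE CLAUSIUS CORRECTOR** of the momentum row `k` (ordered pairs; each unordered pair twice, with equal terms). -/
def corrector (χ χI : ℝ → ℝ) (ε : ℝ) (φ : T3 → ℝ) {N : ℕ} (k : Fin 3) (z : Phase N) : ℝ :=
  ∑ i : Fin (N + 1), ∑ j : Fin (N + 1), if i = j then 0 else
    χ (‖sepT (z i).1 (z j).1‖ / ε) * isoWeight χI ε z i j * (φ (z i).1 - φ (z j).1) * radialForm z i j k

/-- The free-streaming derivative `(L₀ F)(z) = d/ds F(S_s z)|_{s=0}` of a phase functional. -/
def streamDeriv {N : ℕ} (F : Phase N → ℝ) (z : Phase N) : ℝ :=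
  deriv (fun s : ℝ => F (freeFlight (Torus.geometry (Fin 3)) s z)) 0

/-- The ISOLATION-WEIGHTED tested momentum transfer over the window `(a, b]` (ordered records × ½ = once per collision,
exactly as the crux's `Xm k` but with the isolation weight read off the configuration AT the collision, no clamp). -/
def XisoRow (χI : ℝ → ℝ) (σ : ℝ) (φ : T3 → ℝ) {N : ℕ} (Φ : Flow σ N) (k : Fin 3) (a b : ℝ) (z : Phase N) : ℝ :=
  Φ.collisionSum (Set.Ioc a b)
    (fun c => isoWeight χI (hsDiameter σ N) (Φ.flow c.time z) c.fst c.snd * payload φ (some k) c / 2) z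

/-! ## §1 First lemma: the jump identity and the coboundary -/

/-- **FIRST LEMMA (jump identity).** For every flow, every good datum and `h ≥ 0`: the collisional transfer of the
corrector over `(0, h]` equals `4 ×` the isolation-weighted tested transfer — only the colliding pair's own two ordered
terms jump (by `2 I (φ_i − φ_j) Δv_i` each); third-party terms vanish identically at the collision instant. -/
def IsolatedJumpIdentity (δ : ℝ) (χ χI : ℝ → ℝ) : Prop :=
  ShellCutoffs δ χ χI → ∀ (σ : ℝ), 0 < σ → ∀ (N : ℕ) (Φ : Flow σ N) (φ : T3 → ℝ) (k : Fin 3),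
    ∀ z ∈ Φ.good, ∀ h : ℝ, 0 ≤ h →
      Φ.collisionalTransfer (corrector χ χI (hsDiameter σ N) φ k) z h = 4 * XisoRow χI σ φ Φ k 0 h z

/-- **The coboundary identity** (jump identity + landed weak balance law): isolated tested momentum transfer over the
window = `¼ [C_k]₀ʰ − ¼ ∫₀ʰ L₀C_k` — an EXACT rewriting with no clamp and no remainder. -/
def IsolatedTransferCoboundary (δ : ℝ) (χ χI : ℝ → ℝ) : Prop :=
  ShellCutoffs δ χ χI → ∀ (σ : ℝ), 0 < σ → ∀ (N : ℕ) (Φ : Flow σ N) (φ : T3 → ℝ), Torus.IsSmooth φ → ∀ (k : Fin 3),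
    ∀ z ∈ Φ.good, ∀ h : ℝ, 0 ≤ h →
      XisoRow χI σ φ Φ k 0 h z =
        (1 / 4) * (corrector χ χI (hsDiameter σ N) φ k (Φ.flow h z) - corrector χ χI (hsDiameter σ N) φ k z) -
          (1 / 4) * ∫ s in (0 : ℝ)..h, streamDeriv (corrector χ χI (hsDiameter σ N) φ k) (Φ.flow s z)

/-- **Deterministic kinetic bound on the corrector** (kissing-type count: at most `124` spheres in the shell
`ε ≤ r ≤ (1+δ)ε ≤ 2ε` of a given one; `|φ(x_i) − φ(x_j)| ≤ L (1+δ) ε`; `|radialForm| ≤ ‖v_i‖ + ‖v_j‖`). -/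
def CorrectorKineticBound (δ : ℝ) (χ χI : ℝ → ℝ) : Prop :=
  ShellCutoffs δ χ χI → ∀ (ε : ℝ), 0 < ε → ε ≤ 1 / 8 → ∀ (N : ℕ) (φ : T3 → ℝ) (L : ℝ),
    (∀ x y, |φ x - φ y| ≤ L * Torus.euclidDist x y) → ∀ (k : Fin 3),
    ∀ z ∈ hardSphereDomain (Torus.geometry (Fin 3)) (N + 1) ε,
      |corrector χ χI ε φ k z| ≤ 248 * L * (1 + δ) * ε * ∑ i : Fin (N + 1), ‖(z i).2‖

/-! ## §2 The transferred statement C⁺ (momentum rows, constant profiles) and the shadowed residue -/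

/-- **C⁺ = SHELL-STRESS WINDOW LD** (constant profiles; the rung of TwoClocks' C′ for the ISOLATED momentum rows): under
the canonical Gibbs law, the window average of the ADDITIVE phase functional `−¼ L₀C_k`, centred by an EOS projection with
isolated-pair coefficients `c₁(σ,θ₀), c₂(σ,θ₀)` (density / kinetic-energy response of the isolated-pair collisional
pressure), has scale-`N` exponential moment `≤ e^{ε(N+1)}` at every fixed small tilt, window `∃ τ₀ ∀ τ ≥ τ₀`.
No clamp: `|L₀C_k| ≤ C(δ) ‖φ‖_{C²} × (kinetic energy of shell pairs)` pathwise (Gaussian domination). -/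
def ShellStressWindowLD (δ : ℝ) (χ χI : ℝ → ℝ) : Prop :=
  ∀ (a₀ θ₀ : ℝ) (u₀ : V3), 0 < a₀ → 0 < θ₀ → ∃ σ₀ : ℝ, 0 < σ₀ ∧ ∀ σ : ℝ, 0 < σ → σ < σ₀ →
    ∃ c₁ c₂ : ℝ, ∀ (Φ : (N : ℕ) → Flow σ N) (φ : T3 → ℝ), Torus.IsSmooth φ →
    ∃ β₀ : ℝ, 0 < β₀ ∧ ∀ β : ℝ, |β| ≤ β₀ → ∀ ε : ℝ, 0 < ε → ∃ τ₀ : ℝ, 0 < τ₀ ∧ ∀ τ : ℝ, τ₀ ≤ τ →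
    ∃ N₀ : ℕ, ∀ N : ℕ, N₀ ≤ N → ∀ k : Fin 3,
      (let w : ℝ := window τ N
       let D : Phase N → ℝ := streamDeriv (corrector χ χI (hsDiameter σ N) φ k)
       let A : Phase N → ℝ := fun z => ∫ r in (0 : ℝ)..w, ∑ i : Fin (N + 1),
         Torus.partialDeriv k φ ((Φ N).flow r z i).1 * (c₁ + c₂ * ‖((Φ N).flow r z i).2 - u₀‖ ^ 2)
       ∫⁻ z, ENNReal.ofReal (Real.exp (β * (w⁻¹ * (-(1 / 4) * ∫ r in (0 : ℝ)..w, D ((Φ N).flow r z)) - w⁻¹ * A z)))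
           ∂(gibbs σ a₀ θ₀ u₀ N (Φ N)) ≤ ENNReal.ofReal (Real.exp (ε * ((N : ℝ) + 1))))

/-- The SHADOWED clamped tested transfer in row `r`: the crux's `Xrow` with the extra weight `1 − I_c` (transfer clamp
`flagG` kept on both partners). -/
def XshadowRow (χI : ℝ → ℝ) (σ τ V : ℝ) (φ : T3 → ℝ) {N : ℕ} (Φ : Flow σ N) (r : Option (Fin 3)) (z : Phase N) : ℝ :=
  Φ.collisionSum (Set.Ioc 0 (window τ N))
    (fun c => flagG σ τ V Φ c.fst z * flagG σ τ V Φ c.snd z *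
      (1 - isoWeight χI (hsDiameter σ N) (Φ.flow c.time z) c.fst c.snd) * payload φ r c / 2) z

/-- **The shadowed residue (iii-shadow)**: the typed C′ momentum rows restricted to SHADOWED collisions (a third sphere
within `(1+δ)ε` of a partner), transfer clamp as typed, EOS projection with the complementary coefficients. -/
def ShadowedClampedTransferWindowLD (δ : ℝ) (χ χI : ℝ → ℝ) : Prop :=
  ∀ (a₀ θ₀ : ℝ) (u₀ : V3), 0 < a₀ → 0 < θ₀ → ∃ σ₀ : ℝ, 0 < σ₀ ∧ ∀ σ : ℝ, 0 < σ → σ < σ₀ →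
    ∃ c₁ c₂ : ℝ, ∀ (Φ : (N : ℕ) → Flow σ N) (φ : T3 → ℝ), Torus.IsSmooth φ →
    ∃ V₀ : ℝ, 0 < V₀ ∧ ∀ V : ℝ, V₀ ≤ V → ∃ β₀ : ℝ, 0 < β₀ ∧ ∀ β : ℝ, |β| ≤ β₀ → ∀ ε : ℝ, 0 < ε →
    ∃ τ₀ : ℝ, 0 < τ₀ ∧ ∀ τ : ℝ, τ₀ ≤ τ → ∃ N₀ : ℕ, ∀ N : ℕ, N₀ ≤ N → ∀ k : Fin 3,
      (let w : ℝ := window τ N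
       let A : Phase N → ℝ := fun z => ∫ r in (0 : ℝ)..w, ∑ i : Fin (N + 1),
         Torus.partialDeriv k φ ((Φ N).flow r z i).1 * (c₁ + c₂ * ‖((Φ N).flow r z i).2 - u₀‖ ^ 2)
       ∫⁻ z, ENNReal.ofReal (Real.exp (β * (w⁻¹ * XshadowRow χI σ τ V φ (Φ N) (some k) z - w⁻¹ * A z)))
           ∂(gibbs σ a₀ θ₀ u₀ N (Φ N)) ≤ ENNReal.ofReal (Real.exp (ε * ((N : ℝ) + 1))))

/-- **The RE-CUT momentum rows**: isolated part UNCLAMPED (a coboundary) + shadowed part clamped, centred by the crux's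
typed EOS projection `Arow` (up to the choice of coefficients, identified by a static EOS-split lemma at crux-plan). -/
def RecutMomentumRowsWindowLD (δ : ℝ) (χ χI : ℝ → ℝ) : Prop :=
  ∀ (a₀ θ₀ : ℝ) (u₀ : V3), 0 < a₀ → 0 < θ₀ → ∃ σ₀ : ℝ, 0 < σ₀ ∧ ∀ σ : ℝ, 0 < σ → σ < σ₀ →
    ∃ c₁ c₂ : ℝ, ∀ (Φ : (N : ℕ) → Flow σ N) (φ : T3 → ℝ), Torus.IsSmooth φ →
    ∃ V₀ : ℝ, 0 < V₀ ∧ ∀ V : ℝ, V₀ ≤ V → ∃ β₀ : ℝ, 0 < β₀ ∧ ∀ β : ℝ, |β| ≤ β₀ → ∀ ε : ℝ, 0 < ε →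
    ∃ τ₀ : ℝ, 0 < τ₀ ∧ ∀ τ : ℝ, τ₀ ≤ τ → ∃ N₀ : ℕ, ∀ N : ℕ, N₀ ≤ N → ∀ k : Fin 3,
      (let w : ℝ := window τ N
       let A : Phase N → ℝ := fun z => ∫ r in (0 : ℝ)..w, ∑ i : Fin (N + 1),
         Torus.partialDeriv k φ ((Φ N).flow r z i).1 * (c₁ + c₂ * ‖((Φ N).flow r z i).2 - u₀‖ ^ 2)
       ∫⁻ z, ENNReal.ofReal (Real.exp (β *
             (w⁻¹ * (XisoRow χI σ φ (Φ N) k 0 w z + XshadowRow χI σ τ V φ (Φ N) (some k) z) - w⁻¹ * A z)))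
           ∂(gibbs σ a₀ θ₀ u₀ N (Φ N)) ≤ ENNReal.ofReal (Real.exp (ε * ((N : ℝ) + 1))))

/-- **The reduction to be proved at crux-plan (M):** Hölder in the tilt (halving `β₀`, splitting `ε`), the coboundary
identity, and the boundary term `¼ w⁻¹ [C_k]` absorbed INSIDE the reference LD by `CorrectorKineticBound`, Cauchy–Schwarz
and the invariance of the canonical law under the flow (landed `measurePreserving_flow_localGibbsLaw_const`):
`E exp(κ Σ_i (‖v_i(0)‖ + ‖v_i(w)‖)) ≤ E exp(2κ Σ_i ‖v_i‖)`, `κ = 62 β L (1+δ) σ/τ → 0`. -/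
def RecutReduction (δ : ℝ) (χ χI : ℝ → ℝ) : Prop :=
  IsolatedTransferCoboundary δ χ χI → CorrectorKineticBound δ χ χI →
    ShellStressWindowLD δ χ χI → ShadowedClampedTransferWindowLD δ χ χI → RecutMomentumRowsWindowLD δ χ χI

end Summit.AtomisticToContinuum.HydrodynamicLimit.Cruxes.ClampedTransferDock.ClausiusCoboundary
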